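import Summits.HodgeConjecture.HodgeConjecture.Theorems.F0P3SLayerFoldShapesRel   -- ★ p811819 (F0P3-p03 (g5), K4 part 2): `betaOpp_pointwise_of_SLayer_rel` ∕ `_trans`
import HarnessLib

/-!
# Crux `H413` — RUNG 3 under CONTRACT v7: the β_opp-adm folds (S-layer fold shapes with the common finite component ADMISSIBLE)

Floor-0 programme P3 «U3-mult», seat F0P3-p02 (g5); crux item stmt-HodgeConjecture-24833 (`HCCMUnconditional.H413`); rung-1 line
`Cruxes/H413/Lines/F0_U3LettersRung1.lean` ed. 2.7 → 2.8 (CONTRACT v7, F0P3-plan (g3) RULING (R) 2026-08-31T05:30Z: the registered stub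
`stub_betaOpp : StubBetaOpp` becomes `StubBetaOppAdm` = the same text with ONE inserted binder `σ.IsAdmissible →` after `σ.IsSmooth →`; consumer
★ K1″ `F0P3StubBetaOppAdmFold.hodgeTypeRigid_of_betaOppAdm_cpt`).  Sibling of ★ `F0P3SLayerFoldShapes` (K4, p811365) and ★ `F0P3SLayerFoldShapesRel`
(K4 part 2, p811819) — a third file only because of the 400-line rule.  PROOF lane: no `def`, no `sorry`, no named fact asserted;
`--supports stmt-HodgeConjecture-24833`.  HONEST LABEL: HC_CM is proved only modulo the printed citations until rung 0 closes; this file discharges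
none of them.

WHY (ruling (R-b)).  The in-house transfer T♭ «membership in the `ξ`-family passes between discrete `P`, `P′` sharing an irreducible smooth finite
component `σ`» (F0P3-p03 (g5) road I♭ → ★ R2♯ `IsotypicOfCogenerated` → Σ♭ → T♭) needs `σ` ADMISSIBLE; the consumer has admissibility in hand for
holomorphic-type `P` (★ K1″ §1 `isAdmissible_of_hasFinComponent_of_isHolCotangentAt_cpt`, over ★ (A4c) `F0P3FinComponentAdmissible`).  So the
transfer hypothesis gains `σ.IsAdmissible →` (`hTransAdm`) and the fold concludes the body of `StubBetaOppAdm`.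

CONTENTS (datum `L ι H T hT μ` = section variables; packet vocabulary BOUND: `{Ξ : Type*} (Mem : DiscreteAutomorphicRep 𝒢 μ → Ξ → Prop)`;
hypothesis shapes `hS2` ∕ `hS3` ∕ `hSgnRel` = ★ K4-rel's VERBATIM; `hTransAdm` = ★ K4-rel's `hTrans` with `σ.IsAdmissible →` inserted after `σ.IsSmooth →`):
* `betaOppAdm_pointwise_of_SLayer_trans (Mem) (hS2) (hTransAdm) (hSgnRel) : <StubBetaOppAdm body after the datum binders, VERBATIM>` — `ξ` for `P`
  (type `+1`) by (hS2); `Mem P′ ξ` by (hTransAdm) over the common ADMISSIBLE `σ`; `1 = −1` by (hSgnRel).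
* `betaOppAdm_pointwise_of_SLayer_rel (Mem) (hS2) (hS3) (hSgnRel) : <same>` — the S3♭ road in v7 currency (= ★ `betaOpp_pointwise_of_SLayer_rel`
  with the admissibility hypothesis discarded).
Edition 3 of the line instantiates `Ξ := OneDimAutRepH L`, `Mem := MemXiFamily …` (names per rulings (S)∕(S′)) by `intro <datum>; exact …`.

References: [Rogawski1990] J. Rogawski, Ann. of Math. Stud. 123 (1990), Thm. 13.3.5, Thm. 13.3.6 (c), §14.6 Thm. 14.6.4, §12.3 p. 178
(Prop. 12.3.3), Prop. 15.2.1 (b), §15.3 ¶1; [BernsteinZelevinsky1976] §2.1 (admissible representations); [BorelWallach2000] II §5, VI Thm. 4.11.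
-/

-- Mathlib idiom (as in ★ `GKModules`, ★ `F0P3SLayerFoldShapes`): commutator bracket on `Module.End ℂ V`
attribute [local instance 100] LieRing.ofAssociativeRing

set_option autoImplicit false
-- the mandated namespace repeats `HodgeConjecture.HodgeConjecture`, as in every `Theorems/*.lean` of this sub-problem
set_option linter.dupNamespace false

noncomputable section

namespace Summit.HodgeConjecture.HodgeConjecture.Cruxes.H413.F0P3SLayerFoldShapesAdm

open NumberField NumberField.InfinitePlace MeasureTheory
open scoped Matrix MatrixGroups ComplexOrder
open Literature.RepresentationTheory.BorelWallach2000
open Literature.NumberTheory.Automorphic Literature.NumberTheory.Automorphic.UnitaryGroup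
open Literature.NumberTheory.Automorphic.UnitaryGroup.CotangentForms
open Literature.RepresentationTheory.KonnoKonno2007 Literature.RepresentationTheory.KonnoKonno2007.RealDualPair
open Literature.RepresentationTheory.KonnoKonno2007.RealDualPair.UForm

section Datum

/-! Throughout: ONE CM datum `(L, ι, H, T, hT, μ)` as in ★ `F0P3SLayerFoldShapes(Rel)`, and a BOUND packet vocabulary `(Ξ, Mem)`. -/
variable (L : Type) [Field L] [NumberField L] [IsCMField L] (ι : L →+* ℂ) (H : Matrix (Fin 3) (Fin 3) L) (T : GL (Fin 3) ℂ)
  (hT : (T : Matrix (Fin 3) (Fin 3) ℂ)ᴴ * H.map ι * (T : Matrix (Fin 3) (Fin 3) ℂ) = Literature.Geometry.ComplexHyperbolic.BallModel.J)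
  (μ : Measure (adelicGroupData (↥(maximalRealSubfield L)) L (IsCMField.complexConj L) 3 H).automorphicQuotient)
  [(adelicGroupData (↥(maximalRealSubfield L)) L (IsCMField.complexConj L) 3 H).IsAutomorphicMeasure μ]
  {Ξ : Type*}
  (Mem : DiscreteAutomorphicRep (adelicGroupData (↥(maximalRealSubfield L)) L (IsCMField.complexConj L) 3 H) μ → Ξ → Prop)

/-- **β_opp-adm ⇐ S2♭ + ADMISSIBLE TRANSFER + RELATIVE sign clause (pointwise fold; pure logic).**  As ★ `betaOpp_pointwise_of_SLayer_trans`, in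
CONTRACT v7 currency: the common finite component `σ` is irreducible, smooth AND admissible, and the transfer shape `hTransAdm` («membership in the
`ξ`-family passes between discrete `P`, `P′` with a common irreducible smooth ADMISSIBLE finite component», the in-house target T♭) may use that.
`ξ` for `P` (type `+1`) from (hS2), `Mem P′ ξ` by (hTransAdm), then (hSgnRel) gives `1 = −1`.  Conclusion = the body of `StubBetaOppAdm` after the
datum binders, token for token. [cite: Rogawski1990, Thm. 13.3.6 (c); Thm. 13.3.5; §14.6 Thm. 14.6.4; §12.3 p. 178; Prop. 15.2.1 (b); §15.3 ¶1]
[cite: BernsteinZelevinsky1976, §2.1] -/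
theorem betaOppAdm_pointwise_of_SLayer_trans
    (hS2 : ∀ (P : DiscreteAutomorphicRep (adelicGroupData (↥(maximalRealSubfield L)) L (IsCMField.complexConj L) 3 H) μ)
      (M : Type) [AddCommGroup M] [Module ℂ M] (σK : Representation ℂ (uFormGroup (Fin 2) (Fin 1)).maximalCompact M)
      (σ𝔤 : (uFormGroup (Fin 2) (Fin 1)).lie →ₗ⁅ℝ⁆ Module.End ℂ M) (hM : IsGKModule (uFormGroup (Fin 2) (Fin 1)) σK σ𝔤),
      IsIrreducibleGK σK σ𝔤 →
      (∃ T₁ : P.archModuleCM ι T hT →ₗ[ℂ] M,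
        (∀ (k : (uFormGroup (Fin 2) (Fin 1)).maximalCompact) (w : P.archModuleCM ι T hT),
            T₁ (P.archRepKCM ι T hT k w) = σK k (T₁ w)) ∧
          (∀ (X : (uFormGroup (Fin 2) (Fin 1)).lie) (w : P.archModuleCM ι T hT),
            T₁ (P.archRepLieCM ι T hT X w) = σ𝔤 X (T₁ w)) ∧ T₁ ≠ 0) →
      ∀ δ : ℤ, (δ = 1 ∨ δ = -1) → upqTypeClasses σK σ𝔤 hM.ad_compat 1 δ ≠ ⊥ → ∃ ξ : Ξ, Mem P ξ)
    (hTransAdm : ∀ (W : Type) [AddCommGroup W] [Module ℂ W]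
      (σ : Representation ℂ (finAdelic (↥(maximalRealSubfield L)) L (IsCMField.complexConj L) 3 H) W),
      σ.IsIrreducible → σ.IsSmooth → σ.IsAdmissible →
      ∀ (P P' : DiscreteAutomorphicRep (adelicGroupData (↥(maximalRealSubfield L)) L (IsCMField.complexConj L) 3 H) μ) (ξ : Ξ),
        P.HasFinComponent σ → P'.HasFinComponent σ → Mem P ξ → Mem P' ξ)
    (hSgnRel : ∀ (P P' : DiscreteAutomorphicRep (adelicGroupData (↥(maximalRealSubfield L)) L (IsCMField.complexConj L) 3 H) μ)
      (ξ : Ξ), Mem P ξ → Mem P' ξ →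
      ∀ (M : Type) [AddCommGroup M] [Module ℂ M] (σK : Representation ℂ (uFormGroup (Fin 2) (Fin 1)).maximalCompact M)
        (σ𝔤 : (uFormGroup (Fin 2) (Fin 1)).lie →ₗ⁅ℝ⁆ Module.End ℂ M) (hM : IsGKModule (uFormGroup (Fin 2) (Fin 1)) σK σ𝔤),
        IsIrreducibleGK σK σ𝔤 →
        (∃ T₁ : P.archModuleCM ι T hT →ₗ[ℂ] M,
          (∀ (k : (uFormGroup (Fin 2) (Fin 1)).maximalCompact) (w : P.archModuleCM ι T hT),
              T₁ (P.archRepKCM ι T hT k w) = σK k (T₁ w)) ∧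
            (∀ (X : (uFormGroup (Fin 2) (Fin 1)).lie) (w : P.archModuleCM ι T hT),
              T₁ (P.archRepLieCM ι T hT X w) = σ𝔤 X (T₁ w)) ∧ T₁ ≠ 0) →
      ∀ (M' : Type) [AddCommGroup M'] [Module ℂ M'] (σK' : Representation ℂ (uFormGroup (Fin 2) (Fin 1)).maximalCompact M')
        (σ𝔤' : (uFormGroup (Fin 2) (Fin 1)).lie →ₗ⁅ℝ⁆ Module.End ℂ M') (hM' : IsGKModule (uFormGroup (Fin 2) (Fin 1)) σK' σ𝔤'),
        IsIrreducibleGK σK' σ𝔤' →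
        (∃ T₂ : P'.archModuleCM ι T hT →ₗ[ℂ] M',
          (∀ (k : (uFormGroup (Fin 2) (Fin 1)).maximalCompact) (w : P'.archModuleCM ι T hT),
              T₂ (P'.archRepKCM ι T hT k w) = σK' k (T₂ w)) ∧
            (∀ (X : (uFormGroup (Fin 2) (Fin 1)).lie) (w : P'.archModuleCM ι T hT),
              T₂ (P'.archRepLieCM ι T hT X w) = σ𝔤' X (T₂ w)) ∧ T₂ ≠ 0) →
      ∀ (δ δ' : ℤ), (δ = 1 ∨ δ = -1) → (δ' = 1 ∨ δ' = -1) →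
        upqTypeClasses σK σ𝔤 hM.ad_compat 1 δ ≠ ⊥ → upqTypeClasses σK' σ𝔤' hM'.ad_compat 1 δ' ≠ ⊥ → δ = δ') :
    ∀ (W : Type) [AddCommGroup W] [Module ℂ W]
      (σ : Representation ℂ (finAdelic (↥(maximalRealSubfield L)) L (IsCMField.complexConj L) 3 H) W),
      σ.IsIrreducible → σ.IsSmooth → σ.IsAdmissible →
    ∀ (P P' : DiscreteAutomorphicRep (adelicGroupData (↥(maximalRealSubfield L)) L (IsCMField.complexConj L) 3 H) μ),
      P.HasFinComponent σ → P'.HasFinComponent σ →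
    ∀ (M : Type) [AddCommGroup M] [Module ℂ M] (σK : Representation ℂ (uFormGroup (Fin 2) (Fin 1)).maximalCompact M)
      (σ𝔤 : (uFormGroup (Fin 2) (Fin 1)).lie →ₗ⁅ℝ⁆ Module.End ℂ M) (hM : IsGKModule (uFormGroup (Fin 2) (Fin 1)) σK σ𝔤),
      IsIrreducibleGK σK σ𝔤 →
      (∃ T₁ : P.archModuleCM ι T hT →ₗ[ℂ] M,
        (∀ (k : (uFormGroup (Fin 2) (Fin 1)).maximalCompact) (w : P.archModuleCM ι T hT),
            T₁ (P.archRepKCM ι T hT k w) = σK k (T₁ w)) ∧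
          (∀ (X : (uFormGroup (Fin 2) (Fin 1)).lie) (w : P.archModuleCM ι T hT),
            T₁ (P.archRepLieCM ι T hT X w) = σ𝔤 X (T₁ w)) ∧ T₁ ≠ 0) →
    ∀ (M' : Type) [AddCommGroup M'] [Module ℂ M'] (σK' : Representation ℂ (uFormGroup (Fin 2) (Fin 1)).maximalCompact M')
      (σ𝔤' : (uFormGroup (Fin 2) (Fin 1)).lie →ₗ⁅ℝ⁆ Module.End ℂ M') (hM' : IsGKModule (uFormGroup (Fin 2) (Fin 1)) σK' σ𝔤'),
      IsIrreducibleGK σK' σ𝔤' →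
      (∃ T₂ : P'.archModuleCM ι T hT →ₗ[ℂ] M',
        (∀ (k : (uFormGroup (Fin 2) (Fin 1)).maximalCompact) (w : P'.archModuleCM ι T hT),
            T₂ (P'.archRepKCM ι T hT k w) = σK' k (T₂ w)) ∧
          (∀ (X : (uFormGroup (Fin 2) (Fin 1)).lie) (w : P'.archModuleCM ι T hT),
            T₂ (P'.archRepLieCM ι T hT X w) = σ𝔤' X (T₂ w)) ∧ T₂ ≠ 0) →
      upqTypeClasses σK σ𝔤 hM.ad_compat 1 1 ≠ ⊥ → upqTypeClasses σK' σ𝔤' hM'.ad_compat 1 (-1) ≠ ⊥ → False := by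
  intro W _ _ σ hirr hsm hadm P P' hfin hfin' M _ _ σK σ𝔤 hM hirrM hT₁ M' _ _ σK' σ𝔤' hM' hirrM' hT₂ hne hne'
  -- S2♭: `P` lies in the `ξ`-family
  obtain ⟨ξ, hξ⟩ := hS2 P M σK σ𝔤 hM hirrM hT₁ 1 (Or.inl rfl) hne
  -- admissible transfer: so does `P′`, over the common irreducible smooth admissible finite component `σ`
  have hξ' : Mem P' ξ := hTransAdm W σ hirr hsm hadm P P' ξ hfin hfin' hξ
  -- relative sign clause: same family ⇒ same archimedean type, `1 = −1`
  have h := hSgnRel P P' ξ hξ hξ' M σK σ𝔤 hM hirrM hT₁ M' σK' σ𝔤' hM' hirrM' hT₂ 1 (-1) (Or.inl rfl) (Or.inr rfl) hne hne'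
  omega

/-- **β_opp-adm ⇐ S2♭ + S3♭ + RELATIVE sign clause** — ★ `betaOpp_pointwise_of_SLayer_rel` in CONTRACT v7 currency (the admissibility binder is
simply discarded: v7's conclusion is weaker than v6's).  Kept so that ED. 3 of the line has the S3♭ road available against the v7 registered stub.
[cite: Rogawski1990, Thm. 13.3.6 (c); Thm. 13.3.5; §14.6 Thm. 14.6.4; §12.3 p. 178; Prop. 15.2.1 (b); §15.3 ¶1] -/
theorem betaOppAdm_pointwise_of_SLayer_rel
    (hS2 : ∀ (P : DiscreteAutomorphicRep (adelicGroupData (↥(maximalRealSubfield L)) L (IsCMField.complexConj L) 3 H) μ)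
      (M : Type) [AddCommGroup M] [Module ℂ M] (σK : Representation ℂ (uFormGroup (Fin 2) (Fin 1)).maximalCompact M)
      (σ𝔤 : (uFormGroup (Fin 2) (Fin 1)).lie →ₗ⁅ℝ⁆ Module.End ℂ M) (hM : IsGKModule (uFormGroup (Fin 2) (Fin 1)) σK σ𝔤),
      IsIrreducibleGK σK σ𝔤 →
      (∃ T₁ : P.archModuleCM ι T hT →ₗ[ℂ] M,
        (∀ (k : (uFormGroup (Fin 2) (Fin 1)).maximalCompact) (w : P.archModuleCM ι T hT),
            T₁ (P.archRepKCM ι T hT k w) = σK k (T₁ w)) ∧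
          (∀ (X : (uFormGroup (Fin 2) (Fin 1)).lie) (w : P.archModuleCM ι T hT),
            T₁ (P.archRepLieCM ι T hT X w) = σ𝔤 X (T₁ w)) ∧ T₁ ≠ 0) →
      ∀ δ : ℤ, (δ = 1 ∨ δ = -1) → upqTypeClasses σK σ𝔤 hM.ad_compat 1 δ ≠ ⊥ → ∃ ξ : Ξ, Mem P ξ)
    (hS3 : ∀ (W : Type) [AddCommGroup W] [Module ℂ W]
      (σ : Representation ℂ (finAdelic (↥(maximalRealSubfield L)) L (IsCMField.complexConj L) 3 H) W),
      σ.IsIrreducible → σ.IsSmooth →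
      ∀ (P P' : DiscreteAutomorphicRep (adelicGroupData (↥(maximalRealSubfield L)) L (IsCMField.complexConj L) 3 H) μ) (ξ ξ' : Ξ),
        P.HasFinComponent σ → P'.HasFinComponent σ → Mem P ξ → Mem P' ξ' → ξ = ξ')
    (hSgnRel : ∀ (P P' : DiscreteAutomorphicRep (adelicGroupData (↥(maximalRealSubfield L)) L (IsCMField.complexConj L) 3 H) μ)
      (ξ : Ξ), Mem P ξ → Mem P' ξ →
      ∀ (M : Type) [AddCommGroup M] [Module ℂ M] (σK : Representation ℂ (uFormGroup (Fin 2) (Fin 1)).maximalCompact M)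
        (σ𝔤 : (uFormGroup (Fin 2) (Fin 1)).lie →ₗ⁅ℝ⁆ Module.End ℂ M) (hM : IsGKModule (uFormGroup (Fin 2) (Fin 1)) σK σ𝔤),
        IsIrreducibleGK σK σ𝔤 →
        (∃ T₁ : P.archModuleCM ι T hT →ₗ[ℂ] M,
          (∀ (k : (uFormGroup (Fin 2) (Fin 1)).maximalCompact) (w : P.archModuleCM ι T hT),
              T₁ (P.archRepKCM ι T hT k w) = σK k (T₁ w)) ∧
            (∀ (X : (uFormGroup (Fin 2) (Fin 1)).lie) (w : P.archModuleCM ι T hT),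
              T₁ (P.archRepLieCM ι T hT X w) = σ𝔤 X (T₁ w)) ∧ T₁ ≠ 0) →
      ∀ (M' : Type) [AddCommGroup M'] [Module ℂ M'] (σK' : Representation ℂ (uFormGroup (Fin 2) (Fin 1)).maximalCompact M')
        (σ𝔤' : (uFormGroup (Fin 2) (Fin 1)).lie →ₗ⁅ℝ⁆ Module.End ℂ M') (hM' : IsGKModule (uFormGroup (Fin 2) (Fin 1)) σK' σ𝔤'),
        IsIrreducibleGK σK' σ𝔤' →
        (∃ T₂ : P'.archModuleCM ι T hT →ₗ[ℂ] M',
          (∀ (k : (uFormGroup (Fin 2) (Fin 1)).maximalCompact) (w : P'.archModuleCM ι T hT),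
              T₂ (P'.archRepKCM ι T hT k w) = σK' k (T₂ w)) ∧
            (∀ (X : (uFormGroup (Fin 2) (Fin 1)).lie) (w : P'.archModuleCM ι T hT),
              T₂ (P'.archRepLieCM ι T hT X w) = σ𝔤' X (T₂ w)) ∧ T₂ ≠ 0) →
      ∀ (δ δ' : ℤ), (δ = 1 ∨ δ = -1) → (δ' = 1 ∨ δ' = -1) →
        upqTypeClasses σK σ𝔤 hM.ad_compat 1 δ ≠ ⊥ → upqTypeClasses σK' σ𝔤' hM'.ad_compat 1 δ' ≠ ⊥ → δ = δ') :
    ∀ (W : Type) [AddCommGroup W] [Module ℂ W]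
      (σ : Representation ℂ (finAdelic (↥(maximalRealSubfield L)) L (IsCMField.complexConj L) 3 H) W),
      σ.IsIrreducible → σ.IsSmooth → σ.IsAdmissible →
    ∀ (P P' : DiscreteAutomorphicRep (adelicGroupData (↥(maximalRealSubfield L)) L (IsCMField.complexConj L) 3 H) μ),
      P.HasFinComponent σ → P'.HasFinComponent σ →
    ∀ (M : Type) [AddCommGroup M] [Module ℂ M] (σK : Representation ℂ (uFormGroup (Fin 2) (Fin 1)).maximalCompact M)
      (σ𝔤 : (uFormGroup (Fin 2) (Fin 1)).lie →ₗ⁅ℝ⁆ Module.End ℂ M) (hM : IsGKModule (uFormGroup (Fin 2) (Fin 1)) σK σ𝔤),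
      IsIrreducibleGK σK σ𝔤 →
      (∃ T₁ : P.archModuleCM ι T hT →ₗ[ℂ] M,
        (∀ (k : (uFormGroup (Fin 2) (Fin 1)).maximalCompact) (w : P.archModuleCM ι T hT),
            T₁ (P.archRepKCM ι T hT k w) = σK k (T₁ w)) ∧
          (∀ (X : (uFormGroup (Fin 2) (Fin 1)).lie) (w : P.archModuleCM ι T hT),
            T₁ (P.archRepLieCM ι T hT X w) = σ𝔤 X (T₁ w)) ∧ T₁ ≠ 0) →
    ∀ (M' : Type) [AddCommGroup M'] [Module ℂ M'] (σK' : Representation ℂ (uFormGroup (Fin 2) (Fin 1)).maximalCompact M')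
      (σ𝔤' : (uFormGroup (Fin 2) (Fin 1)).lie →ₗ⁅ℝ⁆ Module.End ℂ M') (hM' : IsGKModule (uFormGroup (Fin 2) (Fin 1)) σK' σ𝔤'),
      IsIrreducibleGK σK' σ𝔤' →
      (∃ T₂ : P'.archModuleCM ι T hT →ₗ[ℂ] M',
        (∀ (k : (uFormGroup (Fin 2) (Fin 1)).maximalCompact) (w : P'.archModuleCM ι T hT),
            T₂ (P'.archRepKCM ι T hT k w) = σK' k (T₂ w)) ∧
          (∀ (X : (uFormGroup (Fin 2) (Fin 1)).lie) (w : P'.archModuleCM ι T hT),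
            T₂ (P'.archRepLieCM ι T hT X w) = σ𝔤' X (T₂ w)) ∧ T₂ ≠ 0) →
      upqTypeClasses σK σ𝔤 hM.ad_compat 1 1 ≠ ⊥ → upqTypeClasses σK' σ𝔤' hM'.ad_compat 1 (-1) ≠ ⊥ → False :=
  fun W _ _ σ hirr hsm _ P P' hfin hfin' M _ _ σK σ𝔤 hM hirrM hT₁ M' _ _ σK' σ𝔤' hM' hirrM' hT₂ hne hne' =>
    F0P3SLayerFoldShapesRel.betaOpp_pointwise_of_SLayer_rel L ι H T hT μ Mem hS2 hS3 hSgnRel W σ hirr hsm P P' hfin hfin' M σK σ𝔤 hM hirrM hT₁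
      M' σK' σ𝔤' hM' hirrM' hT₂ hne hne'

end Datum

end Summit.HodgeConjecture.HodgeConjecture.Cruxes.H413.F0P3SLayerFoldShapesAdm

end
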